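import Mathlib
import Summits.Ventures.PercRepro2.TypedSeparatedSides
import Summits.Ventures.PercRepro2.TypedHarrisCluster

/-!
# The separated class of row 2′TRI, II: the identity and the theorem (blind cell PercRepro2,
night-3 g5, 2026-08-25; `proofs/NIGHT3-CERT.md` §14.4–14.7)

On a separated instance (`a₁ ↮ a₂` in `z ∪ F`) with `o, b` on the `l`-side and `a₃` on the
`h`-side, every term of `K₃` is a product of an `l`-side and an `h`-side function of the copies,
so the typed count FACTORISES and the copy symmetry identifies the placements:

  **`typedCount_eq_sep`**: `typedCount F z τ K₃ = 2 · A_H · (S_same − S_cross) · T₀`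

with `A_H = #{a₃ ∉ C_h(x), a₃ ∈ C_h(y)}` (`aDiff`, a count), `S_same − S_cross` the typed Harris
slack of `{o ∈ C_l}, {b ∈ C_l}` (`harrisSlack`, `≥ 0` by `TypedHarris.typedCount_cluster_harris`)
and `T₀` the count of the inert typed edges.  Hence **`typedCount_nonneg_of_sep`**: row 2′TRI on
the separated class, case (ii) — an exact nonnegative-combination certificate whose only
generator is the typed Harris inequality.  (The other placements of `o, b, a₃` on a separated
instance vanish: by the untouched rules of `TypedUntouched(Marks).lean` or by the same algebra —
paper, §14.4.)
-/

namespace Summit.Ventures.PercRepro2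

open UnionCluster

namespace CovForm

namespace Separated

open OneTyped TypedA3 Untouched TypedFactor

/-! ## The theorem -/

section Main

open Classical

variable {V : Type*} {E : Type*} [Fintype E] [DecidableEq E] {R : Type*} [Field R]
  [LinearOrder R] [IsStrictOrderedRing R]
variable (ends : E → Sym2 V) (o a₁ a₂ a₃ b : V)

/-- The `l`-side Harris slack `S_same − S_cross`. -/
noncomputable def harrisSlack (F : Finset E) (z : Config E) (τ : E → ℕ) : R :=
  typedCount (FL ends a₁ F z) z τ (fun x _ _ => iL ends a₁ o x * iL ends a₁ b x) -
    typedCount (FL ends a₁ F z) z τ (fun x y _ => iL ends a₁ o x * iL ends a₁ b y)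

/-- The `h`-side difference count `A_H = #{a₃ ∉ C_h(x), a₃ ∈ C_h(y)}`. -/
noncomputable def aDiff (F : Finset E) (z : Config E) (τ : E → ℕ) : R :=
  typedCount (FL ends a₂ F z) z τ (fun x y _ => (1 - iH ends a₂ a₃ x) * iH ends a₂ a₃ y)

/-- The typed Harris slack is nonnegative (`typedCount_cluster_harris`). -/
theorem harrisSlack_nonneg (F : Finset E) (z : Config E) (τ : E → ℕ)
    (hτ : ∀ e ∈ F, τ e = 1 ∨ τ e = 2) : 0 ≤ harrisSlack (R := R) ends o a₁ b F z τ :=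
  sub_nonneg.2 (TypedHarris.typedCount_cluster_harris (R := R) ends a₁ o b (FL ends a₁ F z) z τ
    fun e he => hτ e (FL_subset ends a₁ F z he))

omit [LinearOrder R] [IsStrictOrderedRing R] in
/-- A typed count of a pointwise nonnegative kernel is nonnegative. -/
lemma typedCount_nonneg_of_kernel_nonneg [LinearOrder R] [IsOrderedRing R] (F : Finset E)
    (z : Config E) (τ : E → ℕ) {K : Config E → Config E → Config E → R}
    (hK : ∀ x y w, 0 ≤ K x y w) : 0 ≤ typedCount F z τ K := by
  unfold typedCount
  refine Finset.sum_nonneg fun x _ => Finset.sum_nonneg fun y _ => Finset.sum_nonneg fun w _ => ?_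
  split_ifs
  · exact hK x y w
  · exact le_refl _

/-- `A_H ≥ 0` (a count). -/
lemma aDiff_nonneg (F : Finset E) (z : Config E) (τ : E → ℕ) :
    0 ≤ aDiff (R := R) ends a₂ a₃ F z τ := by
  refine typedCount_nonneg_of_kernel_nonneg _ _ _ fun x y _ => ?_
  rw [iH_eq_dec, iH_eq_dec]
  split_ifs <;> norm_num

omit [LinearOrder R] [IsStrictOrderedRing R] in
omit [LinearOrder R] [IsStrictOrderedRing R] in
omit [LinearOrder R] [IsStrictOrderedRing R] in
/-- `l`-side cross placement `(y, w)` is `S_cross`. -/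
lemma lside_cross_yw (A : Finset E) (z : Config E) (τ : E → ℕ)
    (hτ : ∀ e ∈ A, τ e = 1 ∨ τ e = 2) :
    typedCount A z τ (fun _ y w => (iL ends a₁ b y : R) * iL ends a₁ o w) =
      typedCount A z τ (fun x y _ => (iL ends a₁ o x : R) * iL ends a₁ b y) := by
  rw [← typedCount_swap13 A z τ hτ (fun x y _ => (iL ends a₁ o x : R) * iL ends a₁ b y)]
  exact typedCount_congr' _ _ _ _ _ fun x y w => mul_comm _ _

omit [LinearOrder R] [IsStrictOrderedRing R] in
/-- `l`-side cross placement `(w, y)` is `S_cross`. -/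
lemma lside_cross_wy (A : Finset E) (z : Config E) (τ : E → ℕ)
    (hτ : ∀ e ∈ A, τ e = 1 ∨ τ e = 2) :
    typedCount A z τ (fun _ y w => (iL ends a₁ o y : R) * iL ends a₁ b w) =
      typedCount A z τ (fun x y _ => (iL ends a₁ o x : R) * iL ends a₁ b y) := by
  rw [← typedCount_swap13 A z τ hτ (fun x y _ => (iL ends a₁ o x : R) * iL ends a₁ b y)]
  exact typedCount_swap23 A z τ hτ (fun x y w => (iL ends a₁ o w : R) * iL ends a₁ b y)

omit [LinearOrder R] [IsStrictOrderedRing R] in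
/-- `l`-side same placement on `w` is `S_same`. -/
lemma lside_same_w (A : Finset E) (z : Config E) (τ : E → ℕ)
    (hτ : ∀ e ∈ A, τ e = 1 ∨ τ e = 2) :
    typedCount A z τ (fun _ _ w => (iL ends a₁ b w : R) * iL ends a₁ o w) =
      typedCount A z τ (fun x _ _ => (iL ends a₁ o x : R) * iL ends a₁ b x) := by
  rw [← typedCount_swap13 A z τ hτ (fun x _ _ => (iL ends a₁ o x : R) * iL ends a₁ b x)]
  exact typedCount_congr' _ _ _ _ _ fun x y w => mul_comm _ _

omit [LinearOrder R] [IsStrictOrderedRing R] in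
/-- `h`-side difference placement `(x, w)` is `A_H`. -/
lemma hside_diff_xw (B : Finset E) (z : Config E) (τ : E → ℕ)
    (hτ : ∀ e ∈ B, τ e = 1 ∨ τ e = 2) :
    typedCount B z τ (fun x _ w => (1 - iH ends a₂ a₃ x : R) * iH ends a₂ a₃ w) =
      typedCount B z τ (fun x y _ => (1 - iH ends a₂ a₃ x : R) * iH ends a₂ a₃ y) := by
  rw [← typedCount_swap23 B z τ hτ (fun x y _ => (1 - iH ends a₂ a₃ x : R) * iH ends a₂ a₃ y)]

omit [LinearOrder R] [IsStrictOrderedRing R] in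
/-- `h`-side difference placement `(y, w)` is `A_H`. -/
lemma hside_diff_yw (B : Finset E) (z : Config E) (τ : E → ℕ)
    (hτ : ∀ e ∈ B, τ e = 1 ∨ τ e = 2) :
    typedCount B z τ (fun _ y w => (1 - iH ends a₂ a₃ y : R) * iH ends a₂ a₃ w) =
      typedCount B z τ (fun x y _ => (1 - iH ends a₂ a₃ x : R) * iH ends a₂ a₃ y) := by
  rw [← typedCount_swap13 B z τ hτ (fun x y _ => (1 - iH ends a₂ a₃ x : R) * iH ends a₂ a₃ y)]
  exact typedCount_swap23 B z τ hτ (fun x y w => (1 - iH ends a₂ a₃ w : R) * iH ends a₂ a₃ y)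

omit [LinearOrder R] [IsStrictOrderedRing R] in
/-- `h`-side double-`P̄` placement `(y, w)` is `B_H`. -/
lemma hside_pp_yw (B : Finset E) (z : Config E) (τ : E → ℕ)
    (hτ : ∀ e ∈ B, τ e = 1 ∨ τ e = 2) :
    typedCount B z τ (fun _ y w => (1 - iH ends a₂ a₃ y : R) * (1 - iH ends a₂ a₃ w)) =
      typedCount B z τ (fun x y _ => (1 - iH ends a₂ a₃ x : R) * (1 - iH ends a₂ a₃ y)) := by
  rw [← typedCount_swap13 B z τ hτ (fun x y _ => (1 - iH ends a₂ a₃ x : R) * (1 - iH ends a₂ a₃ y))]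
  exact typedCount_congr' _ _ _ _ _ fun x y w => mul_comm _ _

omit [LinearOrder R] [IsStrictOrderedRing R] in
/-- `C_H = B_H + A_H`: the single-copy count splits by the second copy. -/
lemma hside_single_split (B : Finset E) (z : Config E) (τ : E → ℕ) :
    typedCount B z τ (fun x _ _ => (1 - iH ends a₂ a₃ x : R)) =
      typedCount B z τ (fun x y _ => (1 - iH ends a₂ a₃ x : R) * (1 - iH ends a₂ a₃ y)) +
        typedCount B z τ (fun x y _ => (1 - iH ends a₂ a₃ x : R) * iH ends a₂ a₃ y) := by
  rw [← typedCount_add']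
  exact typedCount_congr' _ _ _ _ _ fun x y w => by ring


/-! ## The kernel on the support and the identity -/

omit [Fintype E] [LinearOrder R] [IsStrictOrderedRing R] in
/-- On the support of a separated instance (case (ii)), `K₃` is the six-term product kernel in the
`l`-side indicators `L_o, L_b` (through `restr (FL a₁)`) and the `h`-side indicator `H₃`
(through `restr (FL a₂)`). -/
lemma K3_sep_eq (F : Finset E) (z : Config E) (hsep : Sep ends a₁ a₂ F z)
    (ho : o ∈ cluster ends (zF F z) a₁) (hb : b ∈ cluster ends (zF F z) a₁)
    (h3 : a₃ ∈ cluster ends (zF F z) a₂) {x y w : Config E}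
    (hx : ∀ e, e ∉ F → x e = z e) (hy : ∀ e, e ∉ F → y e = z e) (hw : ∀ e, e ∉ F → w e = z e) :
    (K3 ends o a₁ a₂ a₃ b x y w : R) =
      2 * ((iL ends a₁ b (restr (FL ends a₁ F z) z w) * iL ends a₁ o (restr (FL ends a₁ F z) z w)) *
          ((1 - iH ends a₂ a₃ (restr (FL ends a₂ F z) z x)) * iH ends a₂ a₃ (restr (FL ends a₂ F z) z w)))
      + (-1) * ((iL ends a₁ b (restr (FL ends a₁ F z) z y) * iL ends a₁ o (restr (FL ends a₁ F z) z w)) *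
          (1 - iH ends a₂ a₃ (restr (FL ends a₂ F z) z x)))
      + (-1) * ((iL ends a₁ b (restr (FL ends a₁ F z) z y) * iL ends a₁ o (restr (FL ends a₁ F z) z w)) *
          ((1 - iH ends a₂ a₃ (restr (FL ends a₂ F z) z x)) * iH ends a₂ a₃ (restr (FL ends a₂ F z) z w)))
      + (-1) * ((iL ends a₁ o (restr (FL ends a₁ F z) z y) * iL ends a₁ b (restr (FL ends a₁ F z) z w)) *
          ((1 - iH ends a₂ a₃ (restr (FL ends a₂ F z) z y)) * iH ends a₂ a₃ (restr (FL ends a₂ F z) z w)))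
      + 1 * ((iL ends a₁ o (restr (FL ends a₁ F z) z x) * iL ends a₁ b (restr (FL ends a₁ F z) z y)) *
          ((1 - iH ends a₂ a₃ (restr (FL ends a₂ F z) z x)) * iH ends a₂ a₃ (restr (FL ends a₂ F z) z w)))
      + 1 * ((iL ends a₁ b (restr (FL ends a₁ F z) z y) * iL ends a₁ o (restr (FL ends a₁ F z) z w)) *
          ((1 - iH ends a₂ a₃ (restr (FL ends a₂ F z) z y)) *
            (1 - iH ends a₂ a₃ (restr (FL ends a₂ F z) z w)))) := by
  rw [K3_eq_KB, st_sep ends o a₁ a₂ a₃ b F z hsep ho hb h3 hx,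
    st_sep ends o a₁ a₂ a₃ b F z hsep ho hb h3 hy, st_sep ends o a₁ a₂ a₃ b F z hsep ho hb h3 hw,
    KB_sepSt]
  push_cast
  rw [toNat_decide_conn_a1 ends a₁ o F z hx,
    toNat_decide_conn_a2 ends a₂ a₃ F z hx, toNat_decide_conn_a1 ends a₁ o F z hy,
    toNat_decide_conn_a1 ends a₁ b F z hy, toNat_decide_conn_a2 ends a₂ a₃ F z hy,
    toNat_decide_conn_a1 ends a₁ o F z hw, toNat_decide_conn_a1 ends a₁ b F z hw,
    toNat_decide_conn_a2 ends a₂ a₃ F z hw]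
  ring

omit [LinearOrder R] [IsStrictOrderedRing R] in
/-- **The separated-class identity**: `typedCount F z τ K₃ = 2 · A_H · (S_same − S_cross) · T₀`. -/
theorem typedCount_eq_sep (F : Finset E) (z : Config E) (τ : E → ℕ)
    (hτ : ∀ e ∈ F, τ e = 1 ∨ τ e = 2) (hsep : Sep ends a₁ a₂ F z)
    (ho : o ∈ cluster ends (zF F z) a₁) (hb : b ∈ cluster ends (zF F z) a₁)
    (h3 : a₃ ∈ cluster ends (zF F z) a₂) :
    typedCount F z τ (K3 ends o a₁ a₂ a₃ b : Config E → Config E → Config E → R) =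
      2 * aDiff (R := R) ends a₂ a₃ F z τ * harrisSlack (R := R) ends o a₁ b F z τ *
        typedCount (F \ (FL ends a₁ F z ∪ FL ends a₂ F z)) z τ (fun _ _ _ => (1 : R)) := by
  -- the three parts
  set A := FL ends a₁ F z with hAdef
  set B := FL ends a₂ F z with hBdef
  set C := F \ (A ∪ B) with hCdef
  have hAF : A ⊆ F := FL_subset ends a₁ F z
  have hBF : B ⊆ F := FL_subset ends a₂ F z
  have hABF : A ∪ B ⊆ F := Finset.union_subset hAF hBF
  have hF : A ∪ B ∪ C = F := Finset.union_sdiff_of_subset hABF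
  have hAB : Disjoint A B := disjoint_FL ends a₁ a₂ F z hsep
  have hAC : Disjoint A C := Finset.disjoint_sdiff.mono_left Finset.subset_union_left
  have hBC : Disjoint B C := Finset.disjoint_sdiff.mono_left Finset.subset_union_right
  have hτA : ∀ e ∈ A, τ e = 1 ∨ τ e = 2 := fun e he => hτ e (hAF he)
  have hτB : ∀ e ∈ B, τ e = 1 ∨ τ e = 2 := fun e he => hτ e (hBF he)
  -- the six product kernels
  set fS : Config E → Config E → Config E → R := fun _ _ w => iL ends a₁ b w * iL ends a₁ o w
    with hfS
  set fX : Config E → Config E → Config E → R := fun _ y w => iL ends a₁ b y * iL ends a₁ o w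
    with hfX
  set fX' : Config E → Config E → Config E → R := fun _ y w => iL ends a₁ o y * iL ends a₁ b w
    with hfX'
  set fX'' : Config E → Config E → Config E → R := fun x y _ => iL ends a₁ o x * iL ends a₁ b y
    with hfX''
  set gD : Config E → Config E → Config E → R :=
    fun x _ w => (1 - iH ends a₂ a₃ x) * iH ends a₂ a₃ w with hgD
  set gC : Config E → Config E → Config E → R := fun x _ _ => (1 - iH ends a₂ a₃ x) with hgC
  set gD' : Config E → Config E → Config E → R :=
    fun _ y w => (1 - iH ends a₂ a₃ y) * iH ends a₂ a₃ w with hgD'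
  set gP : Config E → Config E → Config E → R :=
    fun _ y w => (1 - iH ends a₂ a₃ y) * (1 - iH ends a₂ a₃ w) with hgP
  -- the kernel on the support
  have hK : typedCount F z τ (K3 ends o a₁ a₂ a₃ b : Config E → Config E → Config E → R) =
      typedCount F z τ (fun x y w =>
        2 * (fS (restr A z x) (restr A z y) (restr A z w) * gD (restr B z x) (restr B z y) (restr B z w))
        + (-1) * (fX (restr A z x) (restr A z y) (restr A z w) * gC (restr B z x) (restr B z y) (restr B z w))
        + (-1) * (fX (restr A z x) (restr A z y) (restr A z w) * gD (restr B z x) (restr B z y) (restr B z w))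
        + (-1) * (fX' (restr A z x) (restr A z y) (restr A z w) * gD' (restr B z x) (restr B z y) (restr B z w))
        + 1 * (fX'' (restr A z x) (restr A z y) (restr A z w) * gD (restr B z x) (restr B z y) (restr B z w))
        + 1 * (fX (restr A z x) (restr A z y) (restr A z w) * gP (restr B z x) (restr B z y) (restr B z w))) := by
    refine typedCount_congr_on_support F z τ fun x y w hxyw _ => ?_
    have hx : ∀ e, e ∉ F → x e = z e := fun e he => (hxyw e he).1
    have hy : ∀ e, e ∉ F → y e = z e := fun e he => (hxyw e he).2.1
    have hw : ∀ e, e ∉ F → w e = z e := fun e he => (hxyw e he).2.2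
    exact K3_sep_eq ends o a₁ a₂ a₃ b F z hsep ho hb h3 hx hy hw
  -- linearity
  rw [hK, typedCount_add', typedCount_add', typedCount_add', typedCount_add', typedCount_add',
    typedCount_smul', typedCount_smul', typedCount_smul', typedCount_smul', typedCount_smul',
    typedCount_smul']
  -- factorisation of each term
  have fac : ∀ (fL gH : Config E → Config E → Config E → R),
      typedCount F z τ (fun x y w =>
        fL (restr A z x) (restr A z y) (restr A z w) * gH (restr B z x) (restr B z y) (restr B z w)) =
      typedCount A z τ fL * typedCount B z τ gH * typedCount C z τ (fun _ _ _ => (1 : R)) := by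
    intro fL gH
    have := typedCount_mul_three A B C hAB hAC hBC z τ fL gH
    rw [hF] at this
    exact this
  rw [fac fS gD, fac fX gC, fac fX gD, fac fX' gD', fac fX'' gD, fac fX gP]
  -- normalise the placements by the copy symmetry
  have eS : typedCount A z τ fS =
      typedCount A z τ (fun x _ _ => (iL ends a₁ o x : R) * iL ends a₁ b x) :=
    lside_same_w ends o a₁ b A z τ hτA
  have eX : typedCount A z τ fX =
      typedCount A z τ (fun x y _ => (iL ends a₁ o x : R) * iL ends a₁ b y) :=
    lside_cross_yw ends o a₁ b A z τ hτA
  have eX' : typedCount A z τ fX' =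
      typedCount A z τ (fun x y _ => (iL ends a₁ o x : R) * iL ends a₁ b y) :=
    lside_cross_wy ends o a₁ b A z τ hτA
  have eX'' : typedCount A z τ fX'' =
      typedCount A z τ (fun x y _ => (iL ends a₁ o x : R) * iL ends a₁ b y) := rfl
  have eD : typedCount B z τ gD =
      typedCount B z τ (fun x y _ => (1 - iH ends a₂ a₃ x : R) * iH ends a₂ a₃ y) :=
    hside_diff_xw ends a₂ a₃ B z τ hτB
  have eD' : typedCount B z τ gD' =
      typedCount B z τ (fun x y _ => (1 - iH ends a₂ a₃ x : R) * iH ends a₂ a₃ y) :=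
    hside_diff_yw ends a₂ a₃ B z τ hτB
  have eP : typedCount B z τ gP =
      typedCount B z τ (fun x y _ => (1 - iH ends a₂ a₃ x : R) * (1 - iH ends a₂ a₃ y)) :=
    hside_pp_yw ends a₂ a₃ B z τ hτB
  have eC : typedCount B z τ gC =
      typedCount B z τ (fun x y _ => (1 - iH ends a₂ a₃ x : R) * (1 - iH ends a₂ a₃ y)) +
        typedCount B z τ (fun x y _ => (1 - iH ends a₂ a₃ x : R) * iH ends a₂ a₃ y) :=
    hside_single_split ends a₂ a₃ B z τ
  rw [eS, eX, eX', eX'', eD, eD', eP, eC]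
  unfold aDiff harrisSlack
  ring


/-- **Row 2′TRI on the separated class, case (ii)**: `a₁ ↮ a₂` in `z ∪ F`, `o, b` on the `l`-side
and `a₃` on the `h`-side ⇒ the typed base is nonnegative — it is `2 · A_H · (S_same − S_cross) · T₀`
with `A_H ≥ 0` (a count), `S_same − S_cross ≥ 0` (typed Harris) and `T₀ ≥ 0`. -/
theorem typedCount_nonneg_of_sep (F : Finset E) (z : Config E) (τ : E → ℕ)
    (hτ : ∀ e ∈ F, τ e = 1 ∨ τ e = 2) (hsep : Sep ends a₁ a₂ F z)
    (ho : o ∈ cluster ends (zF F z) a₁) (hb : b ∈ cluster ends (zF F z) a₁)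
    (h3 : a₃ ∈ cluster ends (zF F z) a₂) :
    0 ≤ typedCount F z τ (K3 ends o a₁ a₂ a₃ b : Config E → Config E → Config E → R) := by
  rw [typedCount_eq_sep ends o a₁ a₂ a₃ b F z τ hτ hsep ho hb h3]
  have h1 := aDiff_nonneg (R := R) ends a₂ a₃ F z τ
  have h2 := harrisSlack_nonneg (R := R) ends o a₁ b F z τ hτ
  have h3' : (0 : R) ≤ typedCount (F \ (FL ends a₁ F z ∪ FL ends a₂ F z)) z τ
      (fun _ _ _ => (1 : R)) :=
    typedCount_nonneg_of_kernel_nonneg _ _ _ fun _ _ _ => zero_le_one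
  positivity

end Main

end Separated

end CovForm

end Summit.Ventures.PercRepro2
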